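import Summits.BirchSwinnertonDyer.BirchSwinnertonDyer.Theorems.KimAtThreeTwoExponentWitnessPairU
import Summits.BirchSwinnertonDyer.BirchSwinnertonDyer.Theorems.KimAtThreeTwoExponentPortOfZetaBody
import HarnessLib

/-!
# Route `KimAtThreeKolyvagin` (rung W2), additive-DEFECT rows of cruxes 19562 / 19599 / 19679:
# ★₂-u — PORT₂ `KatoKuriharaPortThreeAtWith₂TwoExp W 0 e v₃ η P` FROM KATO'S EULER SYSTEM WITHOUT the `hbad`
# row certificate (anomalous bad places INCLUDED), modulo the two-exponent rider and the value rows

Cell `bsd-addord`, seat `bsd-addord-w2-acc3` gen 3 (PROGRAMME PART 1b, plan g16 ACCEL-LIST (3)); `--supports`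
stmt-BirchSwinnertonDyer-19679 (helper; the item OWNER assembles).  END-TYPE TOOL THEOREMS WITH DISPLAYED
HYPOTHESES: no definition, no named fact, no instance, no `sorry`; nothing asserted about any curve; nothing booked;
cruxes 19562 / 19599 / 19679 stay OPEN.

## What

Seat acc6 gen 2's ★₂ / ★₂′ (`KimAtThreeTwoExponentPortOfZetaBody`, p472052) discharge PORT₂ at one `t = 0` additive
row from Kato's `ZetaBody`, the (Λ)-clauses + TWO-EXPONENT riders (ii₂), `hcdA`, the value rows (★₂′: the level-free
value certificates) and THEOREM D's row certificates `hbad` (no `3`-torsion over `ℚ_w` at a bad `w ≠ 3`) and `ht0`.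
Here `hbad` is DELETED: the two theorems are acc6's TOKEN FOR TOKEN, the witness pair coming from this seat's
hbad-free ★★-u (`KimAtThreeTwoExponentWitnessPairU`, on seat w2-c3's THEOREM D-u `KimAtThreeDeepUpperKolyvaginPair`
— the anomalous bad places are served by `ZetaBody`'s own (C2) clause, [MR04] Remark A.5).  Consequence (sequel
`KimAtThreeAdditiveDefectPortOfFineKato`): PORT₂ on EVERY `t = 0` additive-defect row from (C1₂) + (C2₂), and with
w2-c3's theorem (C2₂) from the fine Kato package (C1₂) ALONE — the residual (C3₂) «port on the 3-anomalous rows»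
disappears from 19562 / 19599 / 19679 exactly as (C3) disappeared from 19560 (w2-c3 p471554).

* ★₂-u `katoKuriharaPortThreeAtWith₂TwoExp_zero_of_zetaBody_of_unramified` — value rows displayed.
* ★₂′-u `katoKuriharaPortThreeAtWith₂TwoExp_zero_of_zetaBody_of_unramified_of_valueRows` — value rows discharged by
  n1011-p02's `ValueRow.valueRows_of_zetaBody` (`t := 0`).

HONEST LIMITS: `t = 0` only (`ht0`: `𝓕_can,3 = ⊤`); riders / `hNorm` are hypotheses on bound witnesses
(CONSTRUCTION-SHAPED, never `_holds`); closes nothing; 0 defs / 0 facts / 0 sorry.  Credit: seat acc6 gen 2 (★₂/★₂′),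
seat w2-c3 gen 5 (D-u), team n1011 (★ PK-6₂ and everything under it); this seat only re-keys.
References: [Kato2004Asterisque] (8.1.3), §8.2, Lemma 8.5, Prop. 8.12, §9.4, Thm. 9.7, Thm. 6.6 (1), Ex. 13.3;
[Kim2022StructureSelmer] §2.2.2, §3.2.3, Thm. 3.6, §3.3–§3.4.1, Thm. 3.13; [MazurRubin2004] Def. 3.1.3, Thm. 3.2.4,
App. A (Lemma A.1, Prop. A.2, Remark A.5); [Sakamoto2024] §2, Def. 4.1; [Rubin2000] Def. 4.4.4, Thm. 4.5.1;
[Kim2025RefinedTNC] §4.2, §8.1.2; seat memos W2ACC6-TWOEXP-g2, W2C3-D7U-CHAIN-g5.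
-/

set_option autoImplicit false
-- the Theorems namespace of a single-conjunct summit repeats the summit name by design (D-0017)
set_option linter.dupNamespace false

noncomputable section

open scoped NumberField TensorProduct ContRepresentation Classical
open CategoryTheory Field Function Finset IsDedekindDomain NumberField WeierstrassCurve
open Rat.HeightOneSpectrum
open Literature.NumberTheory.GaloisRepresentations Literature.NumberTheory.GaloisCohomology
open Literature.NumberTheory.GaloisRepresentations.DiscreteGaloisModule
open Literature.NumberTheory.EllipticCurves Literature.NumberTheory.EllipticCurves.ModularForms
open Literature.NumberTheory.EllipticCurves.Rank1Residual
open Literature.NumberTheory.EllipticCurves.Kato2004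
open Literature.NumberTheory.EllipticCurves.Kato2004.EulerSystemValues
open Summit.BirchSwinnertonDyer.Rank1Residual.GaloisImage
open Summit.BirchSwinnertonDyer.BirchSwinnertonDyer.Theorems.KimAtThreeKolyvaginDefs
open Summit.BirchSwinnertonDyer.BirchSwinnertonDyer.Theorems

namespace Summit.BirchSwinnertonDyer.BirchSwinnertonDyer.Theorems.KimAtThreeTwoExponentPortOfZetaBodyU


variable (W : WeierstrassCurve ℚ) [W.IsElliptic] [W.IsGloballyMinimal]
  [ContinuousSMul ℤ_[3] (W.tateModule 3)] [Module.Free ℤ_[3] (W.tateModule 3)]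
  [Module.Finite ℤ_[3] (W.tateModule 3)]

/-- Local notation: `𝐃F⟦r, τ⟧ ℓ = Σ_{j<ℓ−1} j·σ_{χ_{m(0,r)}(τ_ℓ)}^j` on the level field `ℚ(ζ_{m(0,r)})`. -/
local notation3 (prettyPrint := false) "𝐃F⟦" r ", " τ "⟧" =>
  fun ℓ : HeightOneSpectrum (𝓞 ℚ) =>
  ∑ j ∈ Finset.range (((primesEquiv ℓ : Nat.Primes) : ℕ) - 1),
    (j : Module.End ℚ (CyclotomicField (cycLevel 3 0 r) ℚ)) *
      (sigma (cycLevel 3 0 r) (modNCyclotomicCharacter ℚ (cycLevel 3 0 r)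
          ((τ : HeightOneSpectrum (𝓞 ℚ) → absoluteGaloisGroup ℚ) ℓ)) :
        CyclotomicField (cycLevel 3 0 r) ℚ →ₐ[ℚ] CyclotomicField (cycLevel 3 0 r) ℚ).toLinearMap ^ j

/-- Local notation: the TWO-EXPONENT rider clause (ii₂) at depth `j`, torsion exponent `t`, defect exponent
`e`, place `v`, for the pair `(Λ, Λf)` (n1011's `KatoExpStarFiniteLevelAt` clause (ii), conclusion `× 3^e`). -/
local notation3 (prettyPrint := false) "RIDER₂⟦" W' ", " j ", " t' ", " e' ", " v' ", " Λ' ", " Λf "⟧" =>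
  ∀ (r : Finset (HeightOneSpectrum (𝓞 ℚ)))
    (Ψ : H1 (tateRep W' 3) (cycSubgroup 3 0 r) →+
      continuousCohomology 1
        (subgroupRep (WeierstrassCurve.torsionGaloisModule W' (((3 : ℕ) : ℤ) ^ j * ((3 : ℕ) : ℤ))).toTopRep
          (cycSubgroup 3 0 r))),
    (∀ (φ : contOneCocycles (subgroupRep (tateRep W' 3).toTopRep (cycSubgroup 3 0 r)))
        (ψ : contOneCocycles
          (subgroupRep (WeierstrassCurve.torsionGaloisModule W' (((3 : ℕ) : ℤ) ^ j * ((3 : ℕ) : ℤ))).toTopRep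
            (cycSubgroup 3 0 r))),
        (∀ g, ((ψ.1 g : geomTorsion W' (((3 : ℕ) : ℤ) ^ j * ((3 : ℕ) : ℤ))) : geomPoints W') =
          TateModule.proj 3 (j + 1) (φ.1 g)) →
        Ψ (oneCocycleClass _ φ) = oneCocycleClass _ ψ) →
    ∀ (y : H1 (tateRep W' 3) (cycSubgroup 3 0 r))
      (κ₀ : galoisCohomology (WeierstrassCurve.torsionGaloisModule W' (((3 : ℕ) : ℤ) ^ j * ((3 : ℕ) : ℤ))) 1)
      (s : ℤ_[3]),
      resSubgroup (WeierstrassCurve.torsionGaloisModule W' (((3 : ℕ) : ℤ) ^ j * ((3 : ℕ) : ℤ))).toTopRep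
          (cycSubgroup 3 0 r) 1 κ₀ = Ψ y →
      galoisCohomology.localization (WeierstrassCurve.torsionGaloisModule W' (((3 : ℕ) : ℤ) ^ j * ((3 : ℕ) : ℤ)))
          (Sum.inr v') 1 κ₀ ∈ propagatedSelmerStructure W' 3 j (Sum.inr v') →
      (∃ l ∈ cycIntLattice 3 (cycLevel 3 0 r),
          (((3 : ℕ) : ℤ_[3]) ^ t') • Λ' 0 r y - ((s : ℚ_[3]) ⊗ₜ[ℚ] (1 : CyclotomicField (cycLevel 3 0 r) ℚ)) =
            (((3 : ℕ) : ℤ_[3]) ^ (j + 1)) • (l : ℚ_[3] ⊗[ℚ] CyclotomicField (cycLevel 3 0 r) ℚ)) →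
      ((3 ^ e' : ℕ) : ZMod (3 ^ (j + 1))) *
        Λf (galoisCohomology.localization
          (WeierstrassCurve.torsionGaloisModule W' (((3 : ℕ) : ℤ) ^ j * ((3 : ℕ) : ℤ))) (Sum.inr v') 1 κ₀) =
        PadicInt.toZModPow (j + 1) s

set_option backward.isDefEq.respectTransparency false in
/-- **★₂-u: PORT₂ at `t = 0` from Kato's Euler system, THEOREM D-u, the (Λ)-clauses + two-exponent riders and the
value rows — NO `hbad`** (rows with a `3`-anomalous bad place `w ≠ 3` INCLUDED).  Displayed: the parametrisation
datum `P` at the conductor level (`hN`), Kato's witnesses through `hbody` for `P.f`, the functionals `Λfin j` with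
the (Λ)-clauses `hΛ` and the two-exponent scalar compatibilities `hfin₂` (exponent `e`, torsion `0`), `hcdA`,
THEOREM D's certificate `ht0` at the place `3`, the value rows `hvalue` (at `t = 0`); concluded:
`KatoKuriharaPortThreeAtWith₂TwoExp W 0 e v₃ η P` for every generator family `η`.  Seat acc6's ★₂
(`KimAtThreeTwoExponentPortOfZetaBody.katoKuriharaPortThreeAtWith₂TwoExp_zero_of_zetaBody`, p472052) TOKEN FOR TOKEN
with `hbad` deleted, the witness pair taken from ★★-u
(`KimAtThreeTwoExponentWitnessPairU.exists_katoKuriharaWitnessAtTwoExp_pair_of_zetaBody_of_unramified`).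
[cite: Kato2004Asterisque, (8.1.3) (p. 180), §9.4 (p. 188), Thm. 9.7 (p. 189) and Ex. 13.3 (pp. 224–225)]
[cite: Kim2022StructureSelmer, Thm. 3.13 and §1.2.2, §2.2.2, §3.2.3, §3.3–§3.4.1 (arXiv v3 pp. 12, 16–18, 26–27)]
[cite: MazurRubin2004, Def. 3.1.3, Thm. 3.2.4 and App. A (Lemma A.1, Remark A.5)] [cite: Sakamoto2024, §2 and Def. 4.1]
[cite: Kim2025RefinedTNC, §4.2 and §8.1.2] -/
theorem katoKuriharaPortThreeAtWith₂TwoExp_zero_of_zetaBody_of_unramified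
    {N : ℕ} [NeZero N] (P : ModularParametrizationData W N) (hN : N = W.conductorNorm ℤ)
    {ι : (n : ℕ) → (CyclotomicField n ℚ →+* ℂ)} {κK : ℝ}
    {Λ : ∀ (k' : ℕ) (r : Finset (HeightOneSpectrum (𝓞 ℚ))),
      H1 (tateRep W 3) (cycSubgroup 3 k' r) →ₗ[ℤ_[3]] ℚ_[3] ⊗[ℚ] CyclotomicField (cycLevel 3 k' r) ℚ}
    {c d a : ℤ} {A : ℕ}
    {z : ∀ (k' : ℕ) (r : (cyclotomicLevelsRat 3 (badPlaces c d A N)).Ideals),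
      H1 (tateRep W 3) ((cyclotomicLevelsRat 3 (badPlaces c d A N)).level k' r.1)}
    {x : ∀ (k' : ℕ) (r : (cyclotomicLevelsRat 3 (badPlaces c d A N)).Ideals),
      CyclotomicField (cycLevel 3 k' r.1) ℚ}
    (hbody : ZetaBody W 3 P.f ι κK Λ c d a A z x)
    {e : ℕ} {v₃ : HeightOneSpectrum (𝓞 ℚ)}
    (Λfin : ∀ j : ℕ, galoisCohomology ((W.torsionGaloisModule (((3 : ℕ) : ℤ) ^ j * ((3 : ℕ) : ℤ))).toLocal
      (Sum.inr v₃)) 1 →+ ZMod (3 ^ (j + 1)))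
    (hΛ : ∀ j : ℕ,
      (∀ c : ZMod (3 ^ (j + 1)), ∃ x ∈ propagatedSelmerStructure W 3 j (Sum.inr v₃), Λfin j x = c) ∧
      (∀ x ∈ propagatedSelmerStructure W 3 j (Sum.inr v₃),
        Λfin j x = 0 ↔ x ∈ W.kummerSelmerStructure (((3 : ℕ) : ℤ) ^ j * ((3 : ℕ) : ℤ)) (Sum.inr v₃)))
    (hfin₂ : ∀ j : ℕ, RIDER₂⟦W, j, 0, e, v₃, Λ, Λfin j⟧)
    {η : (q : HeightOneSpectrum (𝓞 ℚ)) → (ZMod (Ideal.absNorm q.asIdeal))ˣ}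
    -- the auxiliary datum avoids every prime `≡ 1 (mod 3)` (so every Kolyvagin prime is usable)
    (hcdA : ∀ q : ℕ, q.Prime → q ≡ 1 [MOD 3] → ¬ q ∣ 2 * c.natAbs * d.natAbs * A)
    -- THEOREM D's certificate at the place `3` (`t = 0`); NO `hbad` (anomalous bad places served by `ZetaBody` (C2))
    (ht0 : ∀ w : HeightOneSpectrum (𝓞 ℚ), ((3 : ℕ) : 𝓞 ℚ) ∈ w.asIdeal →
        ∀ Q : (W.baseChange (w.adicCompletion ℚ)).toAffine.Point, 3 • Q = 0 → Q = 0)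
    -- the per-level VALUE ROWS at `t = 0` (T-PK6-VROW's OUT), displayed
    (hvalue : ∀ (j : ℕ) (σ : HeightOneSpectrum (𝓞 ℚ) → absoluteGaloisGroup ℚ),
      (∀ q, σ q ∈ (adicCompletionPrime ℚ q).inertia (absoluteGaloisGroup ℚ)) →
      (∀ q, modNCyclotomicCharacter ℚ (Ideal.absNorm q.asIdeal) (σ q) = η q) →
      ∀ (r : Finset (HeightOneSpectrum (𝓞 ℚ)))
        (hr : ∀ q ∈ r, q ∈ (cyclotomicLevelsRat 3 (badPlaces c d A N)).primes),
        (∀ q ∈ r, Kato.IsKolyvaginPrime W 3 (j + 1) ((primesEquiv q : Nat.Primes) : ℕ)) →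
        (∀ q ∈ r, Subgroup.zpowers (η q) = ⊤) →
        ∃ (s : ℤ_[3]) (u : (ZMod (3 ^ (j + 1)))ˣ)
          (ψ : (ℓ : ℕ) → (ZMod ℓ)ˣ →* Multiplicative (ZMod (3 ^ (j + 1)))),
          (∀ q ∈ r, Function.Surjective (ψ (Ideal.absNorm q.asIdeal))) ∧
          (∃ l ∈ cycIntLattice 3 (cycLevel 3 0 r),
            (((3 : ℕ) : ℤ_[3]) ^ (0 : ℕ)) • ((1 : ℚ_[3]) ⊗ₜ[ℚ]
              ((r.noncommProd 𝐃F⟦r, σ⟧ (ZetaValue.pairwise_commute_fieldDeriv (cycLevel 3 0 r)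
                  (fun ℓ => modNCyclotomicCharacter ℚ (cycLevel 3 0 r) (σ ℓ))
                  (fun ℓ => ((primesEquiv ℓ : Nat.Primes) : ℕ) - 1) r))
                (x 0 ⟨r, hr⟩ + sigma (cycLevel 3 0 r) (-1) (x 0 ⟨r, hr⟩)))) -
              ((s : ℚ_[3]) ⊗ₜ[ℚ] (1 : CyclotomicField (cycLevel 3 0 r) ℚ)) =
            (((3 : ℕ) : ℤ_[3]) ^ (j + 1)) • (l : ℚ_[3] ⊗[ℚ] CyclotomicField (cycLevel 3 0 r) ℚ)) ∧
          haveI : NeZero (∏ q ∈ r, Ideal.absNorm q.asIdeal) :=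
            ⟨Finset.prod_ne_zero_iff.2 fun q _ h => q.ne_bot (Ideal.absNorm_eq_zero_iff.1 h)⟩
          PadicInt.toZModPow (j + 1) s = (u : ZMod (3 ^ (j + 1))) *
            ((3 : ℕ) : ZMod (3 ^ (j + 1))) ^ (0 : ℕ) *
              kuriharaNumber P.f (3 ^ (j + 1)) (∏ q ∈ r, Ideal.absNorm q.asIdeal) ψ) :
    KatoKuriharaPortThreeAtWith₂TwoExp W 0 e v₃ η P := by
  intro k k' D D' red hDW hDW' hkk' hred _hadd hsurj _ht hv₃
  -- the guards
  obtain ⟨hT, hC, S, τ, hS, hτμ, hτq, hP⟩ := hDW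
  obtain ⟨hT', hC', S', τ', hS', hτμ', hτq', hP'⟩ := hDW'
  have hirr : W.HasIrreducibleModPGaloisRep 3 :=
    hasIrreducibleModPGaloisRep_of_hasSurjectiveModNGaloisRep W 3 hsurj
  -- Kolyvagin primes of the right levels (E1-deep on the deep classes of the guards)
  have hKol : ∀ q ∈ D.primes, Kato.IsKolyvaginPrime W 3 (k + 1) ((primesEquiv q : Nat.Primes) : ℕ) :=
    fun q hq => KolyvaginPrime.isKolyvaginPrime_of_mem_frobeniusClassPrimes_of_le W
      (Nat.le_add_right k 0) (fun v hv => (hS v hv).1) hτμ hτq (hP hq)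
  have hKol' : ∀ q ∈ D'.primes, Kato.IsKolyvaginPrime W 3 (k' + 1) ((primesEquiv q : Nat.Primes) : ℕ) :=
    fun q hq => KolyvaginPrime.isKolyvaginPrime_of_mem_frobeniusClassPrimes_of_le W
      (Nat.le_add_right k' 0) (fun v hv => (hS' v hv).1) hτμ' hτq' (hP' hq)
  -- every Kolyvagin prime is a usable prime of Kato's system for `(c, d, A, N)`
  have husable : ∀ (j : ℕ) (q : HeightOneSpectrum (𝓞 ℚ)),
      Kato.IsKolyvaginPrime W 3 (j + 1) ((primesEquiv q : Nat.Primes) : ℕ) →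
        q ∈ (cyclotomicLevelsRat 3 (badPlaces c d A N)).primes := by
    intro j q hq
    have hℓ := hq.prime
    have h13 : ((primesEquiv q : Nat.Primes) : ℕ) ≡ 1 [MOD 3] :=
      hq.modEq_one.of_dvd (dvd_pow_self 3 (Nat.succ_ne_zero j))
    refine (mem_primes_cyclotomicLevelsRat_badPlaces_iff 3 c d A N q).2 ⟨fun hdvd => ?_, hq.ne⟩
    rcases (Nat.Prime.dvd_mul hℓ).mp hdvd with h | h
    · exact hcdA _ hℓ h13 h
    · apply hq.not_dvd
      rw [← hN]
      exact dvd_mul_of_dvd_left h 3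
  have hPr : D.primes ⊆ (cyclotomicLevelsRat 3 (badPlaces c d A N)).primes :=
    fun q hq => husable k q (hKol q hq)
  have hPr' : D'.primes ⊆ (cyclotomicLevelsRat 3 (badPlaces c d A N)).primes :=
    fun q hq => husable k' q (hKol' q hq)
  -- `𝓕_can,3 = ⊤` at every depth (`t = 0`, Mazur–Rubin Lemma A.1 along the reduction tower)
  have htower : ∀ j : ℕ,
      ∃ redj : (W.torsionGaloisModule (((3 : ℕ) : ℤ) ^ (j + 1) * ((3 : ℕ) : ℤ))).toContRepresentation →ⁱL
          (W.torsionGaloisModule (((3 : ℕ) : ℤ) ^ j * ((3 : ℕ) : ℤ))).toContRepresentation,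
        ∀ y : geomTorsion W (((3 : ℕ) : ℤ) ^ (j + 1) * ((3 : ℕ) : ℤ)),
          ((redj y : geomTorsion W (((3 : ℕ) : ℤ) ^ j * ((3 : ℕ) : ℤ))) : geomPoints W) =
            ((3 : ℕ) : ℤ) • (y : geomPoints W) := by
    intro j
    obtain ⟨redj, hredj⟩ := exists_torsionReduction_three W j (j + 1)
    refine ⟨redj, fun y => ?_⟩
    rw [hredj, Nat.add_sub_cancel_left, pow_one]
  choose redT hredT using htower
  have htop : ∀ (j : ℕ) (w : HeightOneSpectrum (𝓞 ℚ)), ((primesEquiv w : Nat.Primes) : ℕ) = 3 →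
      propagatedSelmerStructure W 3 j (Sum.inr w) = ⊤ := by
    intro j w hw
    have hw3 : ((3 : ℕ) : 𝓞 ℚ) ∈ w.asIdeal := KolyvaginPrime.natCast_mem_asIdeal_of_primesEquiv_eq hw
    exact propagatedSelmerStructure_three_eq_top_of_torsion_eq_zero W w hw3 (ht0 w hw3) redT hredT j
  -- the two-exponent witness package at the two depths + (COMP), value rows from `hvalue`
  obtain ⟨κf, κu, h₁, h₂, h₃⟩ :=
    KimAtThreeTwoExponentWitnessPairU.exists_katoKuriharaWitnessAtTwoExp_pair_of_zetaBody_of_unramified W P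
      hbody hirr hkk' red hred hv₃ (hΛ k) (hΛ k') (hfin₂ k) (hfin₂ k') D hT D' hT' hC hC' hPr hPr' hKol hKol'
      (htop k) (htop k')
      (fun σ hI hχ r hr => hvalue k σ hI hχ r (fun q hq => hPr (hr (Finset.mem_coe.2 hq)))
        (fun q hq => hKol q (hr (Finset.mem_coe.2 hq)))
        (fun q hq => hC.zpowers_eq_top (hr (Finset.mem_coe.2 hq))))
      (fun σ hI hχ r hr => hvalue k' σ hI hχ r (fun q hq => hPr' (hr (Finset.mem_coe.2 hq)))
        (fun q hq => hKol' q (hr (Finset.mem_coe.2 hq)))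
        (fun q hq => hC'.zpowers_eq_top (hr (Finset.mem_coe.2 hq))))
  exact ⟨κf, Λfin k, κf, κu, Λfin k', κu, h₁, h₂, fun l hl' hl => ⟨h₃ l hl' hl, h₃ l hl' hl⟩⟩

/-- **★₂′-u: ★₂-u with the value rows DISCHARGED** — PORT₂ `KatoKuriharaPortThreeAtWith₂TwoExp W 0 e v₃ η P` from
`ZetaBody` (displayed `hbody`), the (Λ)-clauses `hΛ`, the two-exponent riders `hfin₂`, `hcdA`, THEOREM D's `ht0`
(NO `hbad`), and the level-free VALUE certificates of n1011's T-PK6-VDIS (`hirr`, `hNorm`/`hκ0`, `d′`/`hcd`/`hdd′`,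
`hAN`, `hpN`, `aM`/`haM`, `hE0`/`hE`, `hR0`/`hR`) — ★₂-u ∘ `ValueRow.valueRows_of_zetaBody` (`t := 0`).  Seat acc6's
★₂′ (p472052) with `hbad` deleted.
[cite: Kato2004Asterisque, §9.4 (p. 188), Thm. 9.7 (p. 189), Thm. 6.6 (1) (p. 163) and Ex. 13.3 (pp. 224–225)]
[cite: Kim2022StructureSelmer, Thm. 3.13 and its proof (arXiv v3 pp. 12, 26–28)] [cite: Kim2025RefinedTNC, §4.2 and §8.1.2] -/
theorem katoKuriharaPortThreeAtWith₂TwoExp_zero_of_zetaBody_of_unramified_of_valueRows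
    {N : ℕ} [NeZero N] (P : ModularParametrizationData W N) (hN : N = W.conductorNorm ℤ)
    {ι : (n : ℕ) → (CyclotomicField n ℚ →+* ℂ)} {κK : ℝ}
    {Λ : ∀ (k' : ℕ) (r : Finset (HeightOneSpectrum (𝓞 ℚ))),
      H1 (tateRep W 3) (cycSubgroup 3 k' r) →ₗ[ℤ_[3]] ℚ_[3] ⊗[ℚ] CyclotomicField (cycLevel 3 k' r) ℚ}
    {c d a : ℤ} {A : ℕ} [NeZero A]
    {z : ∀ (k' : ℕ) (r : (cyclotomicLevelsRat 3 (badPlaces c d A N)).Ideals),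
      H1 (tateRep W 3) ((cyclotomicLevelsRat 3 (badPlaces c d A N)).level k' r.1)}
    {x : ∀ (k' : ℕ) (r : (cyclotomicLevelsRat 3 (badPlaces c d A N)).Ideals),
      CyclotomicField (cycLevel 3 k' r.1) ℚ}
    (hbody : ZetaBody W 3 P.f ι κK Λ c d a A z x)
    {e : ℕ} {v₃ : HeightOneSpectrum (𝓞 ℚ)}
    (Λfin : ∀ j : ℕ, galoisCohomology ((W.torsionGaloisModule (((3 : ℕ) : ℤ) ^ j * ((3 : ℕ) : ℤ))).toLocal
      (Sum.inr v₃)) 1 →+ ZMod (3 ^ (j + 1)))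
    (hΛ : ∀ j : ℕ,
      (∀ c : ZMod (3 ^ (j + 1)), ∃ x ∈ propagatedSelmerStructure W 3 j (Sum.inr v₃), Λfin j x = c) ∧
      (∀ x ∈ propagatedSelmerStructure W 3 j (Sum.inr v₃),
        Λfin j x = 0 ↔ x ∈ W.kummerSelmerStructure (((3 : ℕ) : ℤ) ^ j * ((3 : ℕ) : ℤ)) (Sum.inr v₃)))
    (hfin₂ : ∀ j : ℕ, RIDER₂⟦W, j, 0, e, v₃, Λ, Λfin j⟧)
    {η : (q : HeightOneSpectrum (𝓞 ℚ)) → (ZMod (Ideal.absNorm q.asIdeal))ˣ}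
    (hcdA : ∀ q : ℕ, q.Prime → q ≡ 1 [MOD 3] → ¬ q ∣ 2 * c.natAbs * d.natAbs * A)
    (ht0 : ∀ w : HeightOneSpectrum (𝓞 ℚ), ((3 : ℕ) : 𝓞 ℚ) ∈ w.asIdeal →
        ∀ Q : (W.baseChange (w.adicCompletion ℚ)).toAffine.Point, 3 • Q = 0 → Q = 0)
    -- the VALUE certificates (T-PK6-VDIS), replacing ★₂'s displayed `hvalue`
    (hirr : W.HasIrreducibleModPGaloisRep 3)
    (hNorm : ∃ u : ℚ, (u : ℝ) = κK ∧ padicValRat 3 u = 0) (hκ0 : κK ≠ 0)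
    (d' : ℤ) (hcd : Int.gcd (c * d) A = 1) (hdd' : d * d' ≡ 1 [ZMOD (A : ℤ)])
    (hAN : Nat.Coprime A N) (hpN : 3 ^ 2 ∣ N)
    (aM : ℕ → ℤ) (haM : ∀ q ∈ (3 * A).primeFactors, cuspCoeff P.f q = aM q)
    (hE0 : ∏ q ∈ (3 * A).primeFactors, (1 - (aM q : ℚ) / q + (if q ∣ N then 0 else (1 / q : ℚ))) ≠ 0)
    (hE : padicValRat 3
      (∏ q ∈ (3 * A).primeFactors, (1 - (aM q : ℚ) / q + (if q ∣ N then 0 else (1 / q : ℚ)))) = 0)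
    (hR0 : (c : ℚ) ^ 2 * (d : ℚ) ^ 2 * ratMinusSymbol P.f ((a : ℚ) / A) -
        (c : ℚ) * (d : ℚ) ^ 2 * ratMinusSymbol P.f ((a * c : ℚ) / A) -
        (c : ℚ) ^ 2 * (d : ℚ) * ratMinusSymbol P.f ((a * d' : ℚ) / A) +
        (c : ℚ) * (d : ℚ) * ratMinusSymbol P.f ((a * c * d' : ℚ) / A) ≠ 0)
    (hR : padicValRat 3 ((c : ℚ) ^ 2 * (d : ℚ) ^ 2 * ratMinusSymbol P.f ((a : ℚ) / A) -
        (c : ℚ) * (d : ℚ) ^ 2 * ratMinusSymbol P.f ((a * c : ℚ) / A) -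
        (c : ℚ) ^ 2 * (d : ℚ) * ratMinusSymbol P.f ((a * d' : ℚ) / A) +
        (c : ℚ) * (d : ℚ) * ratMinusSymbol P.f ((a * c * d' : ℚ) / A)) = 0) :
    KatoKuriharaPortThreeAtWith₂TwoExp W 0 e v₃ η P :=
  katoKuriharaPortThreeAtWith₂TwoExp_zero_of_zetaBody_of_unramified W P hN hbody Λfin hΛ hfin₂ hcdA ht0
    (ValueRow.valueRows_of_zetaBody hbody P.isNewformOf (by decide) hirr hNorm hκ0 d' hcd hdd' hAN hpN
      aM haM hE0 hE hR0 hR η)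

end Summit.BirchSwinnertonDyer.BirchSwinnertonDyer.Theorems.KimAtThreeTwoExponentPortOfZetaBodyU

end
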